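import Summits.Schanuel.Schanuel.Theorems.SoloInformedX193TwistFamily

/-!
# X193 kernel line, file F3: deep-column uniqueness (C) from the pair law and the twist laws

Solo seat `solo-Schanuel-informed`, X193 kernel programme (design note
`work/s213/X193-KERNEL-DESIGN.md`, Amendment A11; pen proof `work/s194/X193-pen.md` §2 (C);
files F2 = `SoloInformedX193Service` (the laws, `cap`, `deepCols`), F4a =
`SoloInformedX193TwistFamily` (the twist laws unpacked), F6a = `SoloInformedX193Exceptional`
(the hypothesis family `deepUnique`, consumed by F6c = `SoloInformedX193Assign`)).

A column `k` of a piece `P` of an abstract service structure `D : SoloServiceData ι` is DEEP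
at level `n` (`deepCols`) when it is active (`1 ≤ k ≤ n^σ`), near-root, and its bank
exceeds the cap `cap_n(P) = 2 g_P L_P + B g_P² log (n+2)`.  Pen §2 (C): if `i ≠ j` were two
deep columns of `P`, the twist `Q = twist P i j` (carry column `i` to column `j`) is a
piece `≠ P` of the same degree `g`, of height `L_Q ≤ L_P + g log (max i j)` and of bank
`d_Q^j ≥ d_P^i - g log (max i j)` (TW); the pair law (PAIR) for `(P, Q)` at the single
column `j ≤ K = max i j` gives
`min (d_P^j, d_Q^j) ≤ g L_P + g L_Q + A₁ (2g+1)² log (K+2) ≤ 2 g L_P + (1 + 9 A₁) g² log (n+2)`,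
while both banks exceed `cap_n(P) - g log (max i j) ≥ 2 g L_P + (B - 1) g² log (n+2)`:
absurd once `B ≥ 2 + 9 A₁`.  So from level `1` on every piece has at most one deep column,
`D ∈ deepUnique σ B 1` (`SoloServiceData.deepUnique_of_laws`); in particular
`∃ n₄, D ∈ deepUnique σ (2 + 9 A₁) n₄` (`SoloServiceData.exists_deepUnique_of_laws`, the
form consumed by F6c).  Only (WF) (degrees `≥ 1`), (PAIR) and (TW) are used; the near-root
conjunct of `deepCols` is not.  With this file every auxiliary hypothesis family of the
abstract count (no cheap depth F4, deep-column uniqueness F3, cheap assignability F6c) is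
derived from the seven primitive laws of F2.  No sorries.
-/

namespace Summit.Schanuel.Schanuel.Theorems

/-! ### Pure inequality: the arithmetic core of (C) -/

/-- The arithmetic of pen §2 (C) (DESIGN A11 (i)): with `g ≥ 1`, `A₁ ≥ 0`, `B ≥ 2 + 9 A₁`,
logs `0 ≤ lg ≤ ln` and `lK ≤ ln` (of `max i j`, of `n + 2`, of `K + 2`), a height bound
`LQ ≤ L + g lg`, a transported bank `dPi - g lg ≤ dQj`, the pair bound
`min dPj dQj ≤ g L + g LQ + A₁ (g + g + 1)² lK` and two deep banks
`2 g L + B g² ln < dPi`, `2 g L + B g² ln < dPj` are contradictory. -/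
theorem soloX_two_deep_absurd {g A₁ B L LQ lg ln lK dPi dPj dQj : ℝ} (hg : 1 ≤ g)
    (hA₁ : 0 ≤ A₁) (hB : 2 + 9 * A₁ ≤ B) (hlg : 0 ≤ lg) (hlgn : lg ≤ ln) (hlK : lK ≤ ln)
    (hLQ : LQ ≤ L + g * lg) (hbank : dPi - g * lg ≤ dQj)
    (hpair : min dPj dQj ≤ g * L + g * LQ + A₁ * (g + g + 1) ^ 2 * lK)
    (hdi : 2 * g * L + B * g ^ 2 * ln < dPi) (hdj : 2 * g * L + B * g ^ 2 * ln < dPj) :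
    False := by
  have hln : 0 ≤ ln := hlg.trans hlgn
  have hg0 : 0 ≤ g := by linarith
  have hg2 : 0 ≤ g ^ 2 * ln := by positivity
  -- `g lg ≤ g² ln` and `g² lg ≤ g² ln`
  have hglg : g * lg ≤ g * ln := mul_le_mul_of_nonneg_left hlgn hg0
  have hgln : g * ln ≤ g ^ 2 * ln := by
    rw [pow_two]
    nlinarith [mul_le_mul_of_nonneg_right hg (mul_nonneg hg0 hln)]
  have h1 : g * lg ≤ g ^ 2 * ln := hglg.trans hgln
  have h1' : g ^ 2 * lg ≤ g ^ 2 * ln := mul_le_mul_of_nonneg_left hlgn (by positivity)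
  -- `A₁ (2g+1)² lK ≤ 9 A₁ g² ln`
  have hsq : (g + g + 1) ^ 2 ≤ 9 * g ^ 2 := by nlinarith
  have hsq0 : 0 ≤ A₁ * (g + g + 1) ^ 2 := by positivity
  have h3 : A₁ * (g + g + 1) ^ 2 * lK ≤ 9 * A₁ * g ^ 2 * ln := by
    have e1 : A₁ * (g + g + 1) ^ 2 * lK ≤ A₁ * (g + g + 1) ^ 2 * ln :=
      mul_le_mul_of_nonneg_left hlK hsq0
    have e2 : A₁ * (g + g + 1) ^ 2 * ln ≤ A₁ * (9 * g ^ 2) * ln :=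
      mul_le_mul_of_nonneg_right (mul_le_mul_of_nonneg_left hsq hA₁) hln
    linarith
  -- upper bound of the pair right-hand side
  have hgLQ : g * LQ ≤ g * (L + g * lg) := mul_le_mul_of_nonneg_left hLQ hg0
  have hup : g * L + g * LQ + A₁ * (g + g + 1) ^ 2 * lK ≤
      2 * g * L + (1 + 9 * A₁) * g ^ 2 * ln := by
    have e : g * (L + g * lg) = g * L + g ^ 2 * lg := by ring
    rw [e] at hgLQ
    linarith
  -- lower bound of the minimum
  have hQ : 2 * g * L + B * g ^ 2 * ln - g ^ 2 * ln < dQj := by linarith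
  have hP : 2 * g * L + B * g ^ 2 * ln - g ^ 2 * ln < dPj := by linarith
  have hmin : 2 * g * L + B * g ^ 2 * ln - g ^ 2 * ln < min dPj dQj := lt_min hP hQ
  -- `(1 + 9 A₁) g² ln ≤ (B - 1) g² ln`
  have hBg : (1 + 9 * A₁) * g ^ 2 * ln ≤ (B - 1) * g ^ 2 * ln := by
    have e := mul_le_mul_of_nonneg_right (show 1 + 9 * A₁ ≤ B - 1 by linarith) hg2
    linarith
  linarith

namespace SoloServiceData

variable {ι : Type*} (D : SoloServiceData ι)

/-! ### Two more accessors of the twist law, and the pair law at one column -/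

/-- (TW) identity: `twist P k k = P` (`k ≥ 1`). -/
theorem twist_self (hT : D ∈ twistLaw) (P : ι) {k : ℕ} (hk : 1 ≤ k) : D.twist P k k = P :=
  (hT P k k k hk hk hk).1

/-- (TW) a twist to another column is another piece: `twist P k j ≠ P` for `k ≠ j`
(`k, j ≥ 1`; injectivity in the target column against `twist P k k = P`). -/
theorem twist_ne_self (hT : D ∈ twistLaw) (P : ι) {k j : ℕ} (hk : 1 ≤ k) (hj : 1 ≤ j)
    (h : k ≠ j) : D.twist P k j ≠ P := by
  intro hQ
  have hne := D.twist_ne hT P hk hk hj h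
  rw [D.twist_self hT P hk] at hne
  exact hne hQ.symm

/-- (PAIR) at a single column `1 ≤ j ≤ K` for distinct pieces `P ≠ Q`:
`min (d_P^j, d_Q^j) ≤ g_Q L_P + g_P L_Q + A₁ (g_P + g_Q + 1)² log (K + 2)`. -/
theorem pair_single {A₁ : ℝ} (hP : D ∈ pairLaw A₁) {P Q : ι} (hPQ : P ≠ Q) {K j : ℕ}
    (hj : 1 ≤ j) (hjK : j ≤ K) :
    min (D.bank P j) (D.bank Q j) ≤
      D.deg Q * D.logHt P + D.deg P * D.logHt Q +
        A₁ * ((D.deg P : ℝ) + D.deg Q + 1) ^ 2 * Real.log ((K : ℝ) + 2) := by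
  have h := hP P Q hPQ K {j} (fun k hk => by
    rw [Finset.mem_singleton] at hk
    rw [hk]
    exact ⟨hj, hjK⟩)
  rw [Finset.sum_singleton, Finset.card_singleton, Nat.cast_one] at h
  exact h

/-! ### (C) from the laws -/

/-- **Deep-column uniqueness from the laws** (pen §2 (C); DESIGN A11).  Under (WF), (PAIR)
with constant `A₁ ≥ 0` and (TW), for `σ ≤ 1` and any cap constant `B ≥ 2 + 9 A₁`, at every
level `n ≥ 1` every piece has at most one deep column: `D ∈ deepUnique σ B 1`.  (Two deep
columns `i ≠ j` of `P` are priced by (PAIR) for `P` against the twist `twist P i j` at the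
column `j`, with `K = max i j ≤ n^σ ≤ n`; `soloX_two_deep_absurd` is the arithmetic.) -/
theorem deepUnique_of_laws {c₀ A₁ σ B : ℝ} (hW : D ∈ wellFormed c₀) (hP : D ∈ pairLaw A₁)
    (hT : D ∈ twistLaw) (hσ1 : σ ≤ 1) (hA₁ : 0 ≤ A₁) (hB : 2 + 9 * A₁ ≤ B) :
    D ∈ deepUnique σ B 1 := by
  intro n hn P i hi j hj
  by_contra hne
  obtain ⟨hi1, hiσ, -, hdi⟩ := hi
  obtain ⟨hj1, hjσ, -, hdj⟩ := hj
  -- the twist `Q = twist P i j ≠ P`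
  have hPQ : P ≠ D.twist P i j := (D.twist_ne_self hT P hi1 hj1 hne).symm
  have hg : (1 : ℝ) ≤ D.deg P := by exact_mod_cast hW.1 P
  have hdeg : (D.deg (D.twist P i j) : ℝ) = D.deg P := by
    exact_mod_cast D.deg_twist hT P hi1 hj1
  have hL := D.logHt_twist_le hT P hi1 hj1
  have hbank := D.bank_twist_ge hT P hi1 hj1
  obtain ⟨hl0, hl1⟩ := soloX_log_max_le hσ1 hn hi1 hiσ hjσ
  -- `K = max i j ≤ n`, so `log (K + 2) ≤ log (n + 2)`
  have hn1 : (1 : ℝ) ≤ n := by exact_mod_cast hn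
  have hσn : (n : ℝ) ^ σ ≤ n := by
    calc (n : ℝ) ^ σ ≤ (n : ℝ) ^ (1 : ℝ) := Real.rpow_le_rpow_of_exponent_le hn1 hσ1
      _ = n := Real.rpow_one _
  have hKn : ((max i j : ℕ) : ℝ) ≤ n := by
    rw [Nat.cast_max]
    exact max_le (hiσ.trans hσn) (hjσ.trans hσn)
  have hlogK : Real.log (((max i j : ℕ) : ℝ) + 2) ≤ Real.log ((n : ℝ) + 2) :=
    Real.log_le_log (by positivity) (by linarith)
  -- (PAIR) for `(P, Q)` at `S = {j}`, `K = max i j`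
  have hpair := D.pair_single hP hPQ hj1 (le_max_right i j)
  rw [hdeg] at hpair
  -- the two deep inequalities, with the cap unfolded
  have hdi' : 2 * (D.deg P : ℝ) * D.logHt P + B * (D.deg P : ℝ) ^ 2 * Real.log ((n : ℝ) + 2) <
      D.bank P i := hdi
  have hdj' : 2 * (D.deg P : ℝ) * D.logHt P + B * (D.deg P : ℝ) ^ 2 * Real.log ((n : ℝ) + 2) <
      D.bank P j := hdj
  exact soloX_two_deep_absurd hg hA₁ hB hl0 hl1 hlogK hL hbank hpair hdi' hdj'

/-- The consumer form of deep-column uniqueness (DESIGN A11 (ii)): under (WF), (PAIR), (TW),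
`σ ≤ 1`, `A₁ ≥ 0` there is a level `n₄` with `D ∈ deepUnique σ (2 + 9 A₁) n₄` — the
hypothesis `hU` of `cheapAssignable_of_laws` (file F6c), with `0 ≤ 2 + 9 A₁` as file F7e's
count requires. -/
theorem exists_deepUnique_of_laws {c₀ A₁ σ : ℝ} (hW : D ∈ wellFormed c₀)
    (hP : D ∈ pairLaw A₁) (hT : D ∈ twistLaw) (hσ1 : σ ≤ 1) (hA₁ : 0 ≤ A₁) :
    ∃ n₄ : ℕ, D ∈ deepUnique σ (2 + 9 * A₁) n₄ :=
  ⟨1, D.deepUnique_of_laws hW hP hT hσ1 hA₁ le_rfl⟩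

/-- Monotonicity of `deepUnique` in the threshold level: a later threshold is weaker. -/
theorem deepUnique_mono (σ B : ℝ) {n₄ n₄' : ℕ} (h : n₄ ≤ n₄') :
    (deepUnique σ B n₄ : Set (SoloServiceData ι)) ⊆ deepUnique σ B n₄' :=
  fun _ hD n hn P => hD n (h.trans hn) P

end SoloServiceData

end Summit.Schanuel.Schanuel.Theorems
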